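import Literature.Probability.Independence.BerryEsseen
import Mathlib.Probability.Moments.Variance
import HarnessLib

/-!
# SECOND-ORDER EXPANSION OF `E e^{isZ}` FOR BOUNDED CENTRED VARIABLES AND THE PRODUCT COMPARISON
# `|Π_u E e^{isZ_u} − exp(−s² Σ_u Var Z_u / 2)| ≤ #U · (|s|³K³ + s⁴K⁴)` (the "independent-block" half of Newman's CLT)

Claimed R42 (8)(c) in the cell INBOX at 2026-08-28T13:11:28Z by fkp-10a gen 354 (NEW CLAIM #1 of the gen), under provision (ι) (no coordinator seated since gen 272's closing line l.8385: the lane lead absorbs the registry word, silence = consent; readers fk-ref / fkt-lead / fkp-18r / fkp-10b); lineage row FO-10a-g354 (self-suggested), package g354-newmanclt, label NC-B.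
Helper file of the `fk-continuity` build cell (bschramm lane; `--supports stmt-CriticalPhenomena-4575`); builds on
p205010 (kernel theorem, internal audit signed; external expert review pending). No definitions, no named facts, no
sorries; standard axioms. UNCONDITIONAL. GENERIC: a probability measure `μ` on a measurable space `Ω` and finitely many
bounded centred real "random variables" `Z_u`; no independence or association is assumed here — the file controls the
PRODUCT of the one-block characteristic functions, which in Newman's argument (Newman 1980, proof of Thm. 2, p. 127:
"the proof of the standard central limit theorem") replaces the i.i.d. central limit theorem: since all blocks obey the
same third-order bound, no identical distribution is needed.

* `norm_prod_sub_prod_le_sum` — telescoping `‖Π a_u − Π b_u‖ ≤ Σ ‖a_u − b_u‖` in the closed unit ball of a normed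
  commutative ring.
* `norm_integral_cexp_sub_one_sub_le` — `‖E e^{isZ} − (1 − s² Var(Z)/2)‖ ≤ |s|³ K³` for `|Z| ≤ K`, `E Z = 0`
  (Durrett (3.3.3) with `n = 2`, the tree's `norm_cexp_mul_I_sub_taylor_two_le_cube`, integrated).
* `norm_prod_integral_cexp_sub_exp_le` — for `s² K² ≤ 2`:
  `‖Π_{u∈U} E e^{isZ_u} − exp(−s² Σ_{u∈U} Var(Z_u)/2)‖ ≤ #U · (|s|³K³ + s⁴K⁴)` (`|e^{−x} − 1 + x| ≤ x²` on `[0,1]`).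

## References

* C. M. Newman, *Normal fluctuations and the FKG inequalities*, Comm. Math. Phys. 74 (1980) 119–128, proof of Thm. 2.
  [Newman1980]
* R. Durrett, *Probability: Theory and Examples*, 5th ed. (2019), (3.3.3) and Thm. 3.4.1 (the expansion step).
  [Durrett2019]
* G. Grimmett, *The Random-Cluster Model*, Springer 2006, §4.3 (the intended application: box limits). [Grimmett2006]
-/

noncomputable section

namespace Summit.CriticalPhenomena.PercolationContinuityZ3.Theorems.FK

namespace NewmanCLT

open MeasureTheory ProbabilityTheory Complex Finset
open Literature.Probability.Independence

/-! ### Products in the unit ball -/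

/-- **Telescoping bound** in a normed commutative ring: if `‖a_u‖, ‖b_u‖ ≤ 1` for `u ∈ U` then
`‖Π_{u∈U} a_u − Π_{u∈U} b_u‖ ≤ Σ_{u∈U} ‖a_u − b_u‖`. [cite: Durrett2019, Lemma 3.4.3] -/
theorem norm_prod_sub_prod_le_sum {R ι : Type*} [NormedCommRing R] [NormOneClass R] (U : Finset ι) {a b : ι → R}
    (ha : ∀ u ∈ U, ‖a u‖ ≤ 1) (hb : ∀ u ∈ U, ‖b u‖ ≤ 1) :
    ‖∏ u ∈ U, a u - ∏ u ∈ U, b u‖ ≤ ∑ u ∈ U, ‖a u - b u‖ := by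
  classical
  induction U using Finset.induction_on with
  | empty => simp
  | insert j s hj ih =>
    rw [Finset.prod_insert hj, Finset.prod_insert hj, Finset.sum_insert hj]
    have ha' : ∀ i ∈ s, ‖a i‖ ≤ 1 := fun i hi => ha i (Finset.mem_insert_of_mem hi)
    have hb' : ∀ i ∈ s, ‖b i‖ ≤ 1 := fun i hi => hb i (Finset.mem_insert_of_mem hi)
    have hbj : ‖∏ i ∈ s, b i‖ ≤ 1 :=
      (Finset.norm_prod_le _ _).trans (Finset.prod_le_one (fun i _ => norm_nonneg _) hb')
    have h : a j * ∏ i ∈ s, a i - b j * ∏ i ∈ s, b i =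
        a j * (∏ i ∈ s, a i - ∏ i ∈ s, b i) + (a j - b j) * ∏ i ∈ s, b i := by ring
    rw [h]
    refine (norm_add_le _ _).trans ?_
    have h1 : ‖a j * (∏ i ∈ s, a i - ∏ i ∈ s, b i)‖ ≤ ∑ i ∈ s, ‖a i - b i‖ :=
      (norm_mul_le _ _).trans ((mul_le_of_le_one_left (norm_nonneg _) (ha j (mem_insert_self j s))).trans (ih ha' hb'))
    have h2 : ‖(a j - b j) * ∏ i ∈ s, b i‖ ≤ ‖a j - b j‖ :=
      (norm_mul_le _ _).trans (mul_le_of_le_one_right (norm_nonneg _) hbj)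
    linarith

/-! ### Second-order expansion of the characteristic function of a bounded centred variable -/

variable {Ω : Type*} [MeasurableSpace Ω] {μ : Measure Ω}

/-- **Second-order expansion**: for a measurable `Z` with `|Z| ≤ K` and `E Z = 0` on a probability space and real `s`,
`‖E e^{isZ} − (1 − s² Var(Z)/2)‖ ≤ |s|³ K³` (indeed `≤ |s|³ E|Z|³/6`; integrate `|e^{ix} − 1 − ix + x²/2| ≤ |x|³/6`).
[cite: Durrett2019, (3.3.3); Newman1980, proof of Thm. 2] -/
theorem norm_integral_cexp_sub_one_sub_le [IsProbabilityMeasure μ] {Z : Ω → ℝ} (hZm : Measurable Z) {K : ℝ}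
    (hK : ∀ ω, |Z ω| ≤ K) (h0 : ∫ ω, Z ω ∂μ = 0) (s : ℝ) :
    ‖∫ ω, cexp (((s * Z ω : ℝ) : ℂ) * I) ∂μ - (1 - ((s ^ 2 * Var[Z; μ] / 2 : ℝ) : ℂ))‖ ≤ |s| ^ 3 * K ^ 3 := by
  have hb : ∀ᵐ ω ∂μ, Z ω ∈ Set.Icc (-K) K := ae_of_all _ fun ω => abs_le.1 (hK ω)
  have hi : Integrable Z μ := Integrable.of_mem_Icc (-K) K hZm.aemeasurable hb
  have hi2 : Integrable (fun ω => Z ω ^ 2) μ := (memLp_of_bounded hb hZm.aestronglyMeasurable 2).integrable_sq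
  have hvar : Var[Z; μ] = ∫ ω, Z ω ^ 2 ∂μ := variance_of_integral_eq_zero hZm.aemeasurable h0
  -- the remainder
  set R : Ω → ℂ := fun ω => cexp (((s * Z ω : ℝ) : ℂ) * I) - 1 - ((s * Z ω : ℝ) : ℂ) * I
    + (((s * Z ω : ℝ) : ℂ)) ^ 2 / 2 with hR
  have hRb : ∀ ω, ‖R ω‖ ≤ |s| ^ 3 * K ^ 3 := fun ω => by
    refine (norm_cexp_mul_I_sub_taylor_two_le_cube (s * Z ω)).trans ?_
    rw [abs_mul, mul_pow]
    have h3 : |Z ω| ^ 3 ≤ K ^ 3 := pow_le_pow_left₀ (abs_nonneg _) (hK ω) 3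
    have h6 : |s| ^ 3 * |Z ω| ^ 3 / 6 ≤ |s| ^ 3 * |Z ω| ^ 3 :=
      div_le_self (by positivity) (by norm_num)
    exact h6.trans (mul_le_mul_of_nonneg_left h3 (by positivity))
  -- integrability of the pieces
  have iE : Integrable (fun ω => cexp (((s * Z ω : ℝ) : ℂ) * I)) μ := by
    refine (integrable_const (1 : ℝ)).mono' (by fun_prop) (ae_of_all _ fun ω => ?_)
    rw [Complex.norm_exp_ofReal_mul_I]
  have iL : Integrable (fun ω => ((s * Z ω : ℝ) : ℂ) * I) μ := ((hi.const_mul s).ofReal).mul_const I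
  have iQ : Integrable (fun ω => (((s * Z ω : ℝ) : ℂ)) ^ 2 / 2) μ := by
    have : Integrable (fun ω => ((s ^ 2 * Z ω ^ 2 / 2 : ℝ) : ℂ)) μ := ((hi2.const_mul (s ^ 2)).div_const 2).ofReal
    refine this.congr (ae_of_all _ fun ω => ?_)
    push_cast; ring
  have i1 : Integrable (fun ω => cexp (((s * Z ω : ℝ) : ℂ) * I) - 1) μ := iE.sub' (integrable_const _)
  have i2 : Integrable (fun ω => cexp (((s * Z ω : ℝ) : ℂ) * I) - 1 - ((s * Z ω : ℝ) : ℂ) * I) μ := i1.sub' iL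
  have hint : ∫ ω, R ω ∂μ = ∫ ω, cexp (((s * Z ω : ℝ) : ℂ) * I) ∂μ - (1 - ((s ^ 2 * Var[Z; μ] / 2 : ℝ) : ℂ)) := by
    simp only [hR]
    rw [integral_add i2 iQ, integral_sub i1 iL, integral_sub iE (integrable_const _), integral_const]
    simp only [probReal_univ, one_smul]
    have hlin : ∫ ω, ((s * Z ω : ℝ) : ℂ) * I ∂μ = 0 := by
      rw [integral_mul_const, integral_complex_ofReal, integral_const_mul, h0]; simp
    have hquad : ∫ ω, (((s * Z ω : ℝ) : ℂ)) ^ 2 / 2 ∂μ = ((s ^ 2 * Var[Z; μ] / 2 : ℝ) : ℂ) := by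
      have e : (fun ω => (((s * Z ω : ℝ) : ℂ)) ^ 2 / 2) = fun ω => (((s ^ 2 * (Z ω ^ 2) / 2 : ℝ)) : ℂ) := by
        funext ω; push_cast; ring
      rw [e, integral_complex_ofReal, integral_div, integral_const_mul, hvar]
    rw [hlin, hquad]
    ring
  rw [← hint]
  calc ‖∫ ω, R ω ∂μ‖ ≤ ∫ ω, ‖R ω‖ ∂μ := norm_integral_le_integral_norm _
    _ ≤ ∫ _ω, |s| ^ 3 * K ^ 3 ∂μ :=
        integral_mono_of_nonneg (ae_of_all _ fun ω => norm_nonneg _) (integrable_const _) (ae_of_all _ hRb)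
    _ = |s| ^ 3 * K ^ 3 := by simp

/-! ### Product comparison with the Gaussian characteristic function -/

/-- `|e^{−x} − (1 − x)| ≤ x²` for `0 ≤ x ≤ 1`. [folklore] -/
theorem abs_exp_neg_sub_one_sub_le {x : ℝ} (hx0 : 0 ≤ x) (hx1 : x ≤ 1) : |Real.exp (-x) - (1 - x)| ≤ x ^ 2 := by
  have h := Real.abs_exp_sub_one_sub_id_le (x := -x) (by rw [abs_neg, abs_of_nonneg hx0]; exact hx1)
  rw [neg_sq] at h
  refine le_trans (le_of_eq ?_) h
  congr 1
  ring

/-- **Product comparison**: for measurable `Z_u`, `u ∈ U`, with `|Z_u| ≤ K`, `E Z_u = 0` and `s² K² ≤ 2`,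
`‖Π_{u∈U} E e^{isZ_u} − exp(−s² Σ_{u∈U} Var(Z_u)/2)‖ ≤ #U · (|s|³K³ + s⁴K⁴)`: the one-block expansion, the telescoping
bound, `Var(Z_u) ≤ K²` so that `x_u = s²Var(Z_u)/2 ∈ [0,1]`, and `|e^{−x_u} − (1 − x_u)| ≤ x_u²`. In Newman's proof this
is the step "as in the proof of the standard central limit theorem". [cite: Newman1980, proof of Thm. 2; Durrett2019, Thm. 3.4.1 (proof)] -/
theorem norm_prod_integral_cexp_sub_exp_le [IsProbabilityMeasure μ] {ι : Type*} (U : Finset ι) {Z : ι → Ω → ℝ}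
    (hZm : ∀ u ∈ U, Measurable (Z u)) {K : ℝ} (hK : ∀ u ∈ U, ∀ ω, |Z u ω| ≤ K)
    (h0 : ∀ u ∈ U, ∫ ω, Z u ω ∂μ = 0) {s : ℝ} (hs : s ^ 2 * K ^ 2 ≤ 2) :
    ‖∏ u ∈ U, ∫ ω, cexp (((s * Z u ω : ℝ) : ℂ) * I) ∂μ -
        ((Real.exp (-(s ^ 2 * (∑ u ∈ U, Var[Z u; μ]) / 2)) : ℝ) : ℂ)‖ ≤ #U * (|s| ^ 3 * K ^ 3 + s ^ 4 * K ^ 4) := by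
  -- the three families
  set a : ι → ℂ := fun u => ∫ ω, cexp (((s * Z u ω : ℝ) : ℂ) * I) ∂μ with hadef
  set x : ι → ℝ := fun u => s ^ 2 * Var[Z u; μ] / 2 with hxdef
  set b : ι → ℂ := fun u => ((1 - x u : ℝ) : ℂ) with hbdef
  set c : ι → ℂ := fun u => ((Real.exp (-x u) : ℝ) : ℂ) with hcdef
  have hV : ∀ u ∈ U, Var[Z u; μ] ≤ K ^ 2 := fun u hu => by
    have h := variance_le_sq_of_bounded (μ := μ) (a := -K) (b := K) (X := Z u)
      (ae_of_all _ fun ω => abs_le.1 (hK u hu ω)) (hZm u hu).aemeasurable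
    refine h.trans (le_of_eq ?_)
    ring
  have hx0 : ∀ u ∈ U, 0 ≤ x u := fun u _ => by
    simp only [hxdef]
    exact div_nonneg (mul_nonneg (sq_nonneg _) (variance_nonneg _ _)) (by norm_num)
  have hx1 : ∀ u ∈ U, x u ≤ 1 := fun u hu => by
    simp only [hxdef]
    have := mul_le_mul_of_nonneg_left (hV u hu) (sq_nonneg s)
    linarith
  have hxsq : ∀ u ∈ U, x u ^ 2 ≤ s ^ 4 * K ^ 4 := fun u hu => by
    have h1 : x u ≤ s ^ 2 * K ^ 2 / 2 := by
      simp only [hxdef]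
      exact div_le_div_of_nonneg_right (mul_le_mul_of_nonneg_left (hV u hu) (sq_nonneg s)) (by norm_num)
    have h2 : x u ^ 2 ≤ (s ^ 2 * K ^ 2 / 2) ^ 2 := pow_le_pow_left₀ (hx0 u hu) h1 2
    refine h2.trans ?_
    have : (s ^ 2 * K ^ 2 / 2) ^ 2 = s ^ 4 * K ^ 4 / 4 := by ring
    rw [this]
    exact div_le_self (by positivity) (by norm_num)
  have ha1 : ∀ u ∈ U, ‖a u‖ ≤ 1 := fun u _ => by
    simp only [hadef]
    refine (norm_integral_le_of_norm_le_const (C := 1) (ae_of_all _ fun ω => ?_)).trans (by simp)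
    rw [norm_exp_ofReal_mul_I]
  have hb1 : ∀ u ∈ U, ‖b u‖ ≤ 1 := fun u hu => by
    simp only [hbdef]
    rw [Complex.norm_real, Real.norm_eq_abs, abs_of_nonneg (by linarith [hx1 u hu])]
    linarith [hx0 u hu]
  have hc1 : ∀ u ∈ U, ‖c u‖ ≤ 1 := fun u hu => by
    simp only [hcdef]
    rw [Complex.norm_real, Real.norm_eq_abs, abs_of_pos (Real.exp_pos _), Real.exp_le_one_iff]
    linarith [hx0 u hu]
  -- one-block bounds
  have hab : ∀ u ∈ U, ‖a u - b u‖ ≤ |s| ^ 3 * K ^ 3 := fun u hu => by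
    simp only [hadef, hbdef, hxdef]
    have h := norm_integral_cexp_sub_one_sub_le (μ := μ) (hZm u hu) (hK u hu) (h0 u hu) s
    push_cast at h ⊢
    exact h
  have hbc : ∀ u ∈ U, ‖b u - c u‖ ≤ s ^ 4 * K ^ 4 := fun u hu => by
    simp only [hbdef, hcdef]
    rw [← Complex.ofReal_sub, Complex.norm_real, Real.norm_eq_abs, abs_sub_comm]
    exact (abs_exp_neg_sub_one_sub_le (hx0 u hu) (hx1 u hu)).trans (hxsq u hu)
  -- the product of the `c u` is the Gaussian characteristic function
  have hprodc : ∏ u ∈ U, c u = ((Real.exp (-(s ^ 2 * (∑ u ∈ U, Var[Z u; μ]) / 2)) : ℝ) : ℂ) := by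
    simp only [hcdef]
    rw [← Complex.ofReal_prod, ← Real.exp_sum]
    congr 2
    simp only [hxdef]
    rw [Finset.mul_sum, Finset.sum_div, ← Finset.sum_neg_distrib]
  rw [← hprodc]
  calc ‖∏ u ∈ U, a u - ∏ u ∈ U, c u‖
      = ‖(∏ u ∈ U, a u - ∏ u ∈ U, b u) + (∏ u ∈ U, b u - ∏ u ∈ U, c u)‖ := by rw [sub_add_sub_cancel]
    _ ≤ ‖∏ u ∈ U, a u - ∏ u ∈ U, b u‖ + ‖∏ u ∈ U, b u - ∏ u ∈ U, c u‖ := norm_add_le _ _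
    _ ≤ ∑ u ∈ U, ‖a u - b u‖ + ∑ u ∈ U, ‖b u - c u‖ :=
        add_le_add (norm_prod_sub_prod_le_sum U ha1 hb1) (norm_prod_sub_prod_le_sum U hb1 hc1)
    _ ≤ ∑ u ∈ U, |s| ^ 3 * K ^ 3 + ∑ u ∈ U, s ^ 4 * K ^ 4 :=
        add_le_add (Finset.sum_le_sum hab) (Finset.sum_le_sum hbc)
    _ = #U * (|s| ^ 3 * K ^ 3 + s ^ 4 * K ^ 4) := by
        rw [Finset.sum_const, Finset.sum_const, nsmul_eq_mul, nsmul_eq_mul]; ring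

end NewmanCLT

end Summit.CriticalPhenomena.PercolationContinuityZ3.Theorems.FK
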